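import Literature.AnabelianGeometry.SemiGraphs.Temperoids
import Literature.AlgebraicGeometry.Frobenioids.QuasiTemperoidConnected
import HarnessLib

/-!
# Semi-graphs of anabelioids, §3, Remark 3.1.5 — part 1: `B^temp(Π)` is almost totally epimorphic

Mochizuki, *Semi-graphs of anabelioids*, Publ. RIMS **42** (2006), §3, Remark 3.1.5 (manuscript
p. 34) [cite: MochizukiSemiAnbd2006, Rmk 3.1.5 p.34]: "It is immediate from the definitions that every
temperoid is an almost totally epimorphic category of countably connected type [cf. §0]."  The named
fact `TemperoidAlmostTotallyEpimorphic` of `Temperoids.lean` (abc-iut-L3-t2) is the conjunction of the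
two properties for every category equivalent to a countable product `∏ᵢ B^temp(Πᵢ)`.  This
proof-only file is PART 1 of its discharge: the first property for one factor,
`IsAlmostTotallyEpimorphic (BTemp Π)` — a morphism of `B^temp(Π)` whose domain is non-initial and
whose codomain is connected (= a single `Π`-orbit, by the orbit description of
`Literature.AlgebraicGeometry.Frobenioids.QuasiTemperoidConnected`) is surjective on points, hence an
epimorphism.  Parts 2–3 (countable coproducts and the orbit decomposition in `B^temp(Π)`, i.e.
`IsOfCountablyConnectedType (BTemp Π)`; the countable-product and equivalence-transport layer) are
separate files; the named fact is NOT discharged by this file alone.  No definitions.  Nothing here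
takes a side on [IUTchIII] Cor. 3.12.
-/

namespace Literature.AnabelianGeometry.SemiGraphs

open CategoryTheory
open Literature.AlgebraicGeometry.Frobenioids
open Literature.AlgebraicGeometry.Frobenioids.QuasiTemperoid.BTempConnected

universe u

namespace BTemp

variable {G : Type u} [Group G] [TopologicalSpace G]

/-- A morphism of `B^temp(Π)` that is surjective on points is an epimorphism (the forgetful functor to
sets is faithful). [cite: MochizukiSemiAnbd2006, Rmk 3.1.5 p.34] -/
theorem epi_of_surjective {A B : BTemp G} (f : A ⟶ B)
    (hf : ∀ y : B.obj.V, ∃ x : A.obj.V, (f.hom.hom x : B.obj.V) = y) : Epi f := by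
  refine ⟨fun g h hgh => hom_ext_apply fun y => ?_⟩
  obtain ⟨x, rfl⟩ := hf y
  have := congrArg (fun t => (t.hom.hom x)) hgh
  simpa [ObjectProperty.FullSubcategory.comp_hom, Action.comp_hom, types_comp_apply] using this

/-- A morphism of `B^temp(Π)` from an object with a point to a connected object is an epimorphism.
(Renamed from `epi_of_isConnectedObj`, tree-health F4: that name is abc-iut-L3-t5's in
`BTempStructureProofs.lean`.) [cite: MochizukiSemiAnbd2006, Rmk 3.1.5 p.34] -/
theorem epi_of_point_of_isConnectedObj {A B : BTemp G} (x : A.obj.V) (hB : IsConnectedObj B)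
    (f : A ⟶ B) :
    Epi f :=
  epi_of_surjective f (surjective_of_isConnectedObj x hB f)

variable (G) in
/-- **[SemiAnbd] Remark 3.1.5, first property, for one factor**: `B^temp(Π)` is an almost totally
epimorphic category ([FrdI] §0: every morphism with non-initial domain and connected codomain is an
epimorphism) — for ANY topological group `Π`. [cite: MochizukiSemiAnbd2006, Rmk 3.1.5 p.34] -/
theorem isAlmostTotallyEpimorphic : IsAlmostTotallyEpimorphic (BTemp G) := by
  refine ⟨fun {A B} f hA hB => ?_⟩
  obtain ⟨x⟩ := nonempty_of_isNonemptyObj A hA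
  exact epi_of_point_of_isConnectedObj x hB f

end BTemp

end Literature.AnabelianGeometry.SemiGraphs
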